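import Literature.Geometry.Lorentzian.CoordKornIdentity
import Literature.Geometry.Lorentzian.CoordKIDRowRecovery
import Literature.Geometry.Lorentzian.CoordMomentumConstraintAdjoint
import HarnessLib

/-!
# A pointwise bound for the `Y`-part `adjMomGS Y` of the `γ`-row of the KID operator

Topic `Literature/Geometry/Lorentzian`, coordinate tensor calculus `MetricCoord`: pointwise linear
algebra at ONE point `x` of an open set `V` carrying metric components `G` (`IsMetricOn G V`) at
which `G x` is positive definite. Everything here is PROVED; no definition and no statement of
`Prop` type is introduced.

In the `γ`-row `adjHamG N + adjMomGS Y` of `P*` (Chruściel–Delay 2003, §2) the `Y`-terms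
`M = adjMomGS Y = sym K(∇Y·,·) + ½∇_Y K − ½ div((K(Y,·))^♯) G − ½ (div Y) K` are of first order in
`Y` with coefficients `K, ∇K`. For the coercivity estimate near the boundary they are absorbed
using smallness of `x²|K|`, `x⁴|∇K|` (condition (5.10c)); this file provides the pointwise bound
making that possible. With `Q(A) = tr_G G(A·,A·)` and `|∇K|² = Σ g^{kl}⟨∇_{b_k}K, ∇_{b_l}K⟩`:

* `normSqAt_symAt_le` — `|sym B|² ≤ |B|²`; `normSqAt_comp_le` — `|K(A·,·)|² ≤ |K|² Q(A)`;
  `pairAt_sq_le_normSqAt` — `⟨α,β⟩² ≤ |α|²|β|²` (no symmetry needed);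
  `normSqAt_add_four_le` — `|a+b+c+d|² ≤ 4(|a|²+|b|²+|c|²+|d|²)`;
* `IsMetricOn.sq_divForm_apply_le` — `(Σ g^{kl}(∇_{b_k}K)(b_l,Y))² ≤ n|∇K|²|Y|²`;
  `IsMetricOn.normSqAt_cov₂At_apply_le` — `|∇_Y K|² ≤ |∇K|²|Y|²`;
* **`IsMetricOn.normSqAt_adjMomGS_le`** —
  `|adjMomGS Y|² ≤ (4 + 3n)|K|² Q(∇Y) + (1 + 2n²)|∇K|²|Y|²`.

## References

* P. T. Chruściel, E. Delay, Mém. Soc. Math. Fr. 94 (2003), §2, Thm. 5.9 with (5.10c).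
  [ChruscielDelay2003]
* B. O'Neill, *Semi-Riemannian geometry*, 1983, Ch. 2, Lemma 2.25; Ch. 3, pp. 60–61, p. 86.
  [ONeill1983]
-/

noncomputable section

set_option maxSynthPendingDepth 3

open Set Filter Module Function
open scoped Topology ContDiff

namespace Literature.Geometry.Lorentzian

namespace MetricCoord

variable {E : Type*} [NormedAddCommGroup E] [NormedSpace ℝ E] [FiniteDimensional ℝ E]
  [CompleteSpace E] {ι : Type*} [Fintype ι] (b : Basis ι ℝ E)
  {G : E → E →L[ℝ] E →L[ℝ] ℝ} {V : Set E} {x : E} {K : E → E →L[ℝ] E →L[ℝ] ℝ} {Y : E → E}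

/-! ### Frame inequalities -/

omit [CompleteSpace E] [Fintype ι] in
/-- **`|sym B|² ≤ |B|²`** at a symmetric positive definite point. [cite: ONeill1983, Ch. 3, pp. 60–61] -/
theorem normSqAt_symAt_le (hG : IsMetricOn G V) (hx : x ∈ V)
    (hpos : ∀ v : E, v ≠ 0 → 0 < G x v v) (B : E →L[ℝ] E →L[ℝ] ℝ) :
    normSqAt G x (symAt B) ≤ normSqAt G x B := by
  have hi := hG.isInvertible x hx
  have hs := hG.symm x hx
  obtain ⟨e, he⟩ := exists_orthonormal_basis hs hpos
  rw [normSqAt_eq_sum_frame e he hi hs, normSqAt_eq_sum_frame e he hi hs]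
  have hsw : ∑ i, ∑ j, B (e j) (e i) ^ 2 = ∑ i, ∑ j, B (e i) (e j) ^ 2 := Finset.sum_comm
  have h : ∑ i, ∑ j, symAt B (e i) (e j) ^ 2 ≤
      ∑ i, ∑ j, (2⁻¹ * B (e i) (e j) ^ 2 + 2⁻¹ * B (e j) (e i) ^ 2) := by
    refine Finset.sum_le_sum fun i _ ↦ Finset.sum_le_sum fun j _ ↦ ?_
    rw [symAt_apply]
    nlinarith [sq_nonneg (B (e i) (e j) - B (e j) (e i))]
  refine h.trans (le_of_eq ?_)
  simp only [Finset.sum_add_distrib, ← Finset.mul_sum]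
  rw [hsw]; ring

omit [CompleteSpace E] [Fintype ι] in
/-- **`|K(A·,·)|² ≤ |K|² Q(A)`** at a symmetric positive definite point (`K(Ae_i,e_j) =
Σ_p G(Ae_i,e_p) K(e_p,e_j)` and Cauchy–Schwarz). [cite: ONeill1983, Ch. 2, Lemma 2.25] -/
theorem normSqAt_comp_le (hG : IsMetricOn G V) (hx : x ∈ V)
    (hpos : ∀ v : E, v ≠ 0 → 0 < G x v v) (Kx : E →L[ℝ] E →L[ℝ] ℝ) (A : E →L[ℝ] E) :
    normSqAt G x (Kx.comp A) ≤ normSqAt G x Kx * mtrAt G x ((G x).bilinearComp A A) := by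
  have hi := hG.isInvertible x hx
  have hs := hG.symm x hx
  obtain ⟨e, he⟩ := exists_orthonormal_basis hs hpos
  rw [normSqAt_eq_sum_frame e he hi hs, normSqAt_eq_sum_frame e he hi hs, mtrAt_eq_sum_frame e he hi]
  -- `Q(A) = Σ_i Σ_p G(Ae_i,e_p)²`
  have hQ : ∀ i, (G x).bilinearComp A A (e i) (e i) = ∑ p, G x (A (e i)) (e p) ^ 2 := by
    intro i
    rw [ContinuousLinearMap.bilinearComp_apply, bilin_apply_eq_sum_frame e he (G x) (A (e i)) (A (e i))]
    exact Finset.sum_congr rfl fun p _ ↦ by rw [hs (e p) (A (e i)), sq]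
  have hterm : ∀ i j, (Kx.comp A) (e i) (e j) ^ 2 ≤
      (∑ p, G x (A (e i)) (e p) ^ 2) * ∑ p, Kx (e p) (e j) ^ 2 := by
    intro i j
    rw [ContinuousLinearMap.comp_apply, bilin_apply_eq_sum_frame e he Kx (A (e i)) (e j)]
    exact Finset.sum_mul_sq_le_sq_mul_sq _ _ _
  calc ∑ i, ∑ j, (Kx.comp A) (e i) (e j) ^ 2
      ≤ ∑ i, ∑ j, (∑ p, G x (A (e i)) (e p) ^ 2) * ∑ p, Kx (e p) (e j) ^ 2 :=
        Finset.sum_le_sum fun i _ ↦ Finset.sum_le_sum fun j _ ↦ hterm i j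
    _ = (∑ i, ∑ p, G x (A (e i)) (e p) ^ 2) * ∑ j, ∑ p, Kx (e p) (e j) ^ 2 := by
        rw [Finset.sum_mul_sum]
    _ = (∑ p, ∑ j, Kx (e p) (e j) ^ 2) * ∑ i, (G x).bilinearComp A A (e i) (e i) := by
        rw [mul_comm, Finset.sum_comm (f := fun j p ↦ Kx (e p) (e j) ^ 2)]
        exact congrArg₂ (· * ·) rfl (Finset.sum_congr rfl fun i _ ↦ (hQ i).symm)

omit [CompleteSpace E] [Fintype ι] in
/-- **`⟨α, β⟩² ≤ |α|² |β|²`** at a symmetric positive definite point (any forms `α, β`).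
[cite: ONeill1983, Ch. 3, pp. 60–61] -/
theorem pairAt_sq_le_normSqAt (hG : IsMetricOn G V) (hx : x ∈ V)
    (hpos : ∀ v : E, v ≠ 0 → 0 < G x v v) (α β : E →L[ℝ] E →L[ℝ] ℝ) :
    pairAt G x α β ^ 2 ≤ normSqAt G x α * normSqAt G x β := by
  have hi := hG.isInvertible x hx
  have hs := hG.symm x hx
  obtain ⟨e, he⟩ := exists_orthonormal_basis hs hpos
  have hflat : ∀ f : Fin (finrank ℝ E) → Fin (finrank ℝ E) → ℝ,
      ∑ i, ∑ j, f i j = ∑ p : Fin (finrank ℝ E) × Fin (finrank ℝ E), f p.1 p.2 :=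
    fun f ↦ (Fintype.sum_prod_type' f).symm
  have hsw : ∑ i, ∑ j, α (e j) (e i) ^ 2 = ∑ i, ∑ j, α (e i) (e j) ^ 2 := Finset.sum_comm
  rw [pairAt_eq_sum_frame e he hi hs, normSqAt_eq_sum_frame e he hi hs,
    normSqAt_eq_sum_frame e he hi hs, ← hsw, hflat, hflat, hflat]
  exact Finset.sum_mul_sq_le_sq_mul_sq _ _ _

omit [CompleteSpace E] [Fintype ι] in
/-- **`|a + b + c + d|² ≤ 4(|a|² + |b|² + |c|² + |d|²)`** at a symmetric positive definite point.
[cite: ONeill1983, Ch. 3, pp. 60–61] -/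
theorem normSqAt_add_four_le (hG : IsMetricOn G V) (hx : x ∈ V)
    (hpos : ∀ v : E, v ≠ 0 → 0 < G x v v) (α β γ δ : E →L[ℝ] E →L[ℝ] ℝ) :
    normSqAt G x (α + β + γ + δ) ≤
      4 * (normSqAt G x α + normSqAt G x β + normSqAt G x γ + normSqAt G x δ) := by
  have h1 := normSqAt_add_le hG hx hpos (α + β) (γ + δ)
  have h2 := normSqAt_add_le hG hx hpos α β
  have h3 := normSqAt_add_le hG hx hpos γ δ
  rw [show α + β + γ + δ = (α + β) + (γ + δ) by abel]
  linarith

/-! ### `∇K` against a vector -/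

omit [CompleteSpace E] in
/-- **`(Σ g^{kl}(∇_{b_k}K)(b_l, Y))² ≤ n |∇K|² |Y|²`** for a smooth field of symmetric forms `K`, at a
positive definite point (`Σ g^{kl}(∇_{b_k}K)(b_l,Y) = Σ_c (∇_{e_c}K)(e_c,Y)` in an orthonormal frame,
then Cauchy–Schwarz twice). [cite: ONeill1983, Ch. 3, p. 86] -/
theorem IsMetricOn.sq_divForm_apply_le (hG : IsMetricOn G V) (hx : x ∈ V)
    (hpos : ∀ v : E, v ≠ 0 → 0 < G x v v) (hK : ContDiffOn ℝ ∞ K V)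
    (hKs : ∀ y ∈ V, ∀ v w, K y v w = K y w v) (Yx : E) :
    (∑ k, ∑ l, ginv G b x k l * cov₂At G K x (b k) (b l) Yx) ^ 2 ≤
      finrank ℝ E * (∑ k, ∑ l, ginv G b x k l * pairAt G x (cov₂At G K x (b k)) (cov₂At G K x (b l)))
        * G x Yx Yx := by
  have hi := hG.isInvertible x hx
  have hs := hG.symm x hx
  obtain ⟨e, he⟩ := exists_orthonormal_basis hs hpos
  have hsym : ∀ c (v w : E), cov₂At G K x (e c) v w = cov₂At G K x (e c) w v :=
    fun c ↦ hG.cov₂At_symm_of_symmOn hx hK hKs (e c)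
  -- frame forms of the two contractions
  have hL : ∑ k, ∑ l, ginv G b x k l * cov₂At G K x (b k) (b l) Yx =
      ∑ c, cov₂At G K x (e c) (e c) Yx :=
    sum_ginv_bilin_eq_sum_frame e he hi b (fun v w ↦ cov₂At G K x v w Yx)
      (fun u₁ u₂ w ↦ by simp only [map_add, _root_.add_apply])
      (fun c u w ↦ by simp only [map_smul, _root_.smul_apply, smul_eq_mul])
      (fun u w₁ w₂ ↦ by simp only [map_add, _root_.add_apply])
      (fun c u w ↦ by simp only [map_smul, _root_.smul_apply, smul_eq_mul])
  have hN : ∑ k, ∑ l, ginv G b x k l * pairAt G x (cov₂At G K x (b k)) (cov₂At G K x (b l)) =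
      ∑ c, normSqAt G x (cov₂At G K x (e c)) := by
    rw [hG.sum_ginv_pairAt_cov₂At_eq_sum_frame b hx e he K]
    exact Finset.sum_congr rfl fun c _ ↦ pairAt_self_of_symm G x (hsym c)
  rw [hL, hN]
  -- Cauchy–Schwarz in `c`, then for each form against `(e_c, Y)`
  have h1 : (∑ c, cov₂At G K x (e c) (e c) Yx) ^ 2 ≤
      (∑ _c : Fin (finrank ℝ E), (1 : ℝ) ^ 2) * ∑ c, cov₂At G K x (e c) (e c) Yx ^ 2 := by
    have h := Finset.sum_mul_sq_le_sq_mul_sq Finset.univ (fun _ : Fin (finrank ℝ E) ↦ (1 : ℝ))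
      (fun c ↦ cov₂At G K x (e c) (e c) Yx)
    simpa only [one_mul] using h
  have hn : (∑ _c : Fin (finrank ℝ E), (1 : ℝ) ^ 2) = finrank ℝ E := by simp
  rw [hn] at h1
  have h2 : ∀ c, cov₂At G K x (e c) (e c) Yx ^ 2 ≤ normSqAt G x (cov₂At G K x (e c)) * G x Yx Yx := by
    intro c
    have h := apply_sq_le_normSqAt_mul hG hx hpos (cov₂At G K x (e c)) (e c) Yx
    have hee : G x (e c) (e c) = 1 := by rw [he]; simp
    rwa [hee, one_mul] at h
  calc (∑ c, cov₂At G K x (e c) (e c) Yx) ^ 2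
      ≤ finrank ℝ E * ∑ c, cov₂At G K x (e c) (e c) Yx ^ 2 := h1
    _ ≤ finrank ℝ E * ∑ c, normSqAt G x (cov₂At G K x (e c)) * G x Yx Yx :=
        mul_le_mul_of_nonneg_left (Finset.sum_le_sum fun c _ ↦ h2 c) (Nat.cast_nonneg _)
    _ = finrank ℝ E * (∑ c, normSqAt G x (cov₂At G K x (e c))) * G x Yx Yx := by
        rw [← Finset.sum_mul]; ring

omit [CompleteSpace E] in
/-- **`|∇_Y K|² ≤ |∇K|² |Y|²`** for a smooth field of symmetric forms, at a positive definite
point (`IsMetricOn.normSqAt_cov₂At_sharpAt_le` with `φ = G(Y,·)`). [cite: ONeill1983, Ch. 3, p. 86] -/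
theorem IsMetricOn.normSqAt_cov₂At_apply_le (hG : IsMetricOn G V) (hx : x ∈ V)
    (hpos : ∀ v : E, v ≠ 0 → 0 < G x v v) (hK : ContDiffOn ℝ ∞ K V)
    (hKs : ∀ y ∈ V, ∀ v w, K y v w = K y w v) (Yx : E) :
    normSqAt G x (cov₂At G K x Yx) ≤
      (∑ k, ∑ l, ginv G b x k l * pairAt G x (cov₂At G K x (b k)) (cov₂At G K x (b l)))
        * G x Yx Yx := by
  have hi := hG.isInvertible x hx
  have h := hG.normSqAt_cov₂At_sharpAt_le b hx hpos hK hKs (G x Yx)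
  rwa [sharpAt_apply hi] at h

/-! ### The bound for `adjMomGS Y` -/

/-- **`|adjMomGS Y|² ≤ (4 + 3n)|K|² Q(∇Y) + (1 + 2n²)|∇K|²|Y|²`** at a positive definite point of
`V`, for smooth symmetric `K` and smooth `Y`
(`adjMomGS Y = sym K(∇Y·,·) + ½∇_Y K − ½ div((K(Y,·))^♯) G − ½ (div Y) K`,
`div((K(Y,·))^♯) = Σ g^{kl}(∇_{b_k}K)(b_l,Y) + ⟨K, G(∇Y·,·)⟩`).
[cite: ChruscielDelay2003, §2, Thm. 5.9 with (5.10c)] -/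
theorem IsMetricOn.normSqAt_adjMomGS_le (hG : IsMetricOn G V) (hx : x ∈ V)
    (hpos : ∀ v : E, v ≠ 0 → 0 < G x v v) (hK : ContDiffOn ℝ ∞ K V)
    (hKs : ∀ y ∈ V, ∀ v w, K y v w = K y w v) (hY : ContDiffOn ℝ ∞ Y V) :
    normSqAt G x (adjMomGS G K Y x) ≤
      (4 + 3 * finrank ℝ E) * (normSqAt G x (K x)
          * mtrAt G x ((G x).bilinearComp (covDAt G Y x) (covDAt G Y x)))
        + (1 + 2 * (finrank ℝ E : ℝ) ^ 2)
          * ((∑ k, ∑ l, ginv G b x k l * pairAt G x (cov₂At G K x (b k)) (cov₂At G K x (b l)))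
            * G x (Y x) (Y x)) := by
  have hi := hG.isInvertible x hx
  have hs := hG.symm x hx
  have hYd : DifferentiableAt ℝ Y x := ((hY x hx).contDiffAt (hG.mem_nhds hx)).differentiableAt (by simp)
  -- notation
  set A := covDAt G Y x with hA
  set Q := mtrAt G x ((G x).bilinearComp A A) with hQ
  set nK := normSqAt G x (K x) with hnK
  set cN := ∑ k, ∑ l, ginv G b x k l * pairAt G x (cov₂At G K x (b k)) (cov₂At G K x (b l)) with hcN
  set nY := G x (Y x) (Y x) with hnY
  set P := ∑ k, ∑ l, ginv G b x k l * cov₂At G K x (b k) (b l) (Y x) with hP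
  set n : ℝ := (finrank ℝ E : ℝ) with hn
  have hn0 : 0 ≤ n := Nat.cast_nonneg _
  have hQ0 : 0 ≤ Q := hG.mtrAt_bilinearComp_nonneg hx hpos A
  have hnK0 : 0 ≤ nK := normSqAt_nonneg_of_pos hG hx hpos (K x)
  have hcN0 : 0 ≤ cN := hG.covNormSq_nonneg b hx hpos hK hKs
  have hnY0 : 0 ≤ nY := by
    by_cases hz : Y x = 0
    · simp [hnY, hz]
    · exact (hpos _ hz).le
  -- the divergence of `(K(Y,·))^♯`
  have hdiv : divAt G (fun y ↦ sharpAt G y (K y (Y y))) x = P + pairAt G x (K x) ((G x).comp A) :=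
    hG.divAt_sharpAt_contractVec b hx hK hKs hYd
  -- the four terms
  have t1 : normSqAt G x (symAt ((K x).comp A)) ≤ nK * Q :=
    (normSqAt_symAt_le hG hx hpos _).trans (normSqAt_comp_le hG hx hpos (K x) A)
  have t2 : normSqAt G x ((2⁻¹ : ℝ) • cov₂At G K x (Y x)) ≤ 4⁻¹ * (cN * nY) := by
    rw [normSqAt_smul]
    have h := hG.normSqAt_cov₂At_apply_le b hx hpos hK hKs (Y x)
    nlinarith
  have t3 : normSqAt G x (-((2⁻¹ * divAt G (fun y ↦ sharpAt G y (K y (Y y))) x) • G x)) ≤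
      2⁻¹ * n * (n * (cN * nY)) + 2⁻¹ * n * (nK * Q) := by
    rw [show -((2⁻¹ * divAt G (fun y ↦ sharpAt G y (K y (Y y))) x) • G x) =
        (-(2⁻¹ * divAt G (fun y ↦ sharpAt G y (K y (Y y))) x)) • G x by rw [neg_smul],
      normSqAt_smul, normSqAt_metric hi hs, hdiv, ← hn]
    have hP2 : P ^ 2 ≤ n * cN * nY := hG.sq_divForm_apply_le b hx hpos hK hKs (Y x)
    have hR2 : pairAt G x (K x) ((G x).comp A) ^ 2 ≤ nK * Q := by
      have h := pairAt_sq_le_normSqAt hG hx hpos (K x) ((G x).comp A)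
      rwa [hG.normSqAt_metric_comp hx hpos A] at h
    nlinarith [sq_nonneg (P - pairAt G x (K x) ((G x).comp A))]
  have t4 : normSqAt G x (-((2⁻¹ * divAt G Y x) • K x)) ≤ 4⁻¹ * n * (Q * nK) := by
    rw [show -((2⁻¹ * divAt G Y x) • K x) = (-(2⁻¹ * divAt G Y x)) • K x by rw [neg_smul],
      normSqAt_smul]
    have hd2 : divAt G Y x ^ 2 ≤ n * Q := by
      have h := mtrAt_sq_le_normSqAt hG hx hpos ((G x).comp A)
      rwa [mtrAt_metric_comp_covDAt hi, hG.normSqAt_metric_comp hx hpos A, ← hn] at h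
    nlinarith
  -- assemble
  have hM : adjMomGS G K Y x = symAt ((K x).comp A) + (2⁻¹ : ℝ) • cov₂At G K x (Y x)
      + -((2⁻¹ * divAt G (fun y ↦ sharpAt G y (K y (Y y))) x) • G x)
      + -((2⁻¹ * divAt G Y x) • K x) := by
    rw [adjMomGS, sub_eq_add_neg, sub_eq_add_neg]
  rw [hM]
  refine (normSqAt_add_four_le hG hx hpos _ _ _ _).trans ?_
  nlinarith [t1, t2, t3, t4, mul_nonneg hnK0 hQ0, mul_nonneg hcN0 hnY0]

end MetricCoord

end Literature.Geometry.Lorentzian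

end
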